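import Summits.AtomisticToContinuum.FouriersLaw.Theorems.ParityLiouvilleSeedWindowLimitDefs
import Literature.MathematicalPhysics.KineticTheory.LangevinChainScalingLimit

/-!
# The Liouville operator on box observables of the pinned chain: continuity, moment bounds, convergence
(helper for `WindowLimit`)

Helper file for the route item `ParityLiouvilleSeed.WindowLimit` (`stmt-AtomisticToContinuum-13982`).
For the pinned chain `P = pinnedChain ω₂ lam β γ` with ARBITRARY real parameters and a profile
`g : (Fin (2R+1) → ℝ × ℝ) → ℝ` of class `C¹` with `‖Dg‖ ≤ K`:

* `continuous_pinnedChain_force`, `pinnedChain_abs_force_le` — the force `F_z` is continuous and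
  `|F_z(σ)| ≤ C_F (1 + |q_{z-1}|³ + |q_z|³ + |q_{z+1}|³)`, `C_F = |ω₂| + |lam| + 4 + 8|β|`;
* `continuous_liouvilleZ_comp_boxRestrict` — `σ ↦ 𝒜(g ∘ box_R)(σ)` is continuous;
* `abs_liouvilleZ_comp_boxRestrict_le` — `|𝒜(g ∘ box_R)(σ)| ≤ A + B ∑_{|z| ≤ R+1} (|q_z|³ + |p_z|³)` with
  `A, B` depending only on `R, K` and the parameters (the site-weight form used by the transfer lemma);
* `tendsto_liouvilleZ_comp_boxRestrict` — if `Dg_j(y) v → Dg(y) v` pointwise then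
  `𝒜(g_j ∘ box_R)(σ) → 𝒜(g ∘ box_R)(σ)` at every configuration.

Nothing here closes an item.
-/

noncomputable section

namespace Summit.AtomisticToContinuum.FouriersLaw.Theorems.WindowLimit

open MeasureTheory Filter Topology Set
open scoped ContDiff
open Literature.MathematicalPhysics.KineticTheory
open Literature.MathematicalPhysics.KineticTheory.HeatConduction

variable {ω₂ lam β γ : ℝ}

/-! ### The force of the pinned chain on configurations -/

/-- The force of the pinned chain in closed form: `F_z = -(ω₂ q_z + lam q_z³) + (r₊ + β r₊³) - (r₋ + β r₋³)`,
`r₊ = q_{z+1} - q_z`, `r₋ = q_z - q_{z-1}`. [folklore] -/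
theorem pinnedChain_force_eq (ω₂ lam β γ : ℝ) (σ : ChainConfig) (z : ℤ) :
    (pinnedChain ω₂ lam β γ).force σ z =
      -(ω₂ * (σ z).1 + lam * (σ z).1 ^ 3) +
        (((σ (z + 1)).1 - (σ z).1) + β * ((σ (z + 1)).1 - (σ z).1) ^ 3) -
          (((σ z).1 - (σ (z - 1)).1) + β * ((σ z).1 - (σ (z - 1)).1) ^ 3) := by
  rw [OscillatorChain.force_eq, pinnedChain_deriv_U, pinnedChain_deriv_V, pinnedChain_deriv_V]

/-- The force of the pinned chain is continuous in the configuration. [folklore] -/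
theorem continuous_pinnedChain_force (ω₂ lam β γ : ℝ) (z : ℤ) :
    Continuous fun σ : ChainConfig => (pinnedChain ω₂ lam β γ).force σ z := by
  simp only [pinnedChain_force_eq]
  fun_prop

/-- `(x + y)³ ≤ 4(x³ + y³)` for `x, y ≥ 0`. [folklore] -/
theorem add_pow_three_le {x y : ℝ} (hx : 0 ≤ x) (hy : 0 ≤ y) : (x + y) ^ 3 ≤ 4 * (x ^ 3 + y ^ 3) := by
  nlinarith [sq_nonneg (x - y), mul_nonneg hx hy, mul_nonneg (mul_nonneg hx hy) (add_nonneg hx hy)]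

/-- `|t| ≤ 1 + |t|³`. [folklore] -/
theorem abs_le_one_add_abs_pow_three (t : ℝ) : |t| ≤ 1 + |t| ^ 3 := by
  have h := abs_nonneg t
  rcases le_total |t| 1 with h1 | h1
  · linarith [pow_nonneg h 3]
  · have h3 : |t| ≤ |t| ^ 3 := by
      calc |t| = |t| * 1 * 1 := by ring
        _ ≤ |t| * |t| * |t| := by gcongr
        _ = |t| ^ 3 := by ring
    linarith

/-- `|r + β r³| ≤ (2 + 4|β|)(1 + |a|³ + |b|³)` for a difference `r = a - b`. [folklore] -/
theorem abs_sub_add_mul_pow_le (β a b : ℝ) :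
    |(a - b) + β * (a - b) ^ 3| ≤ (2 + 4 * |β|) * (1 + |a| ^ 3 + |b| ^ 3) := by
  have hr : |a - b| ≤ |a| + |b| := abs_sub _ _
  have hr3 : |a - b| ^ 3 ≤ 4 * (|a| ^ 3 + |b| ^ 3) :=
    (pow_le_pow_left₀ (abs_nonneg _) hr 3).trans (add_pow_three_le (abs_nonneg a) (abs_nonneg b))
  have ha := abs_le_one_add_abs_pow_three a
  have hb := abs_le_one_add_abs_pow_three b
  calc |(a - b) + β * (a - b) ^ 3| ≤ |a - b| + |β| * |a - b| ^ 3 := by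
        refine (abs_add_le _ _).trans (add_le_add le_rfl ?_)
        rw [abs_mul, abs_pow]
    _ ≤ (|a| + |b|) + |β| * (4 * (|a| ^ 3 + |b| ^ 3)) := add_le_add hr (mul_le_mul_of_nonneg_left hr3 (abs_nonneg β))
    _ ≤ (2 + 4 * |β|) * (1 + |a| ^ 3 + |b| ^ 3) := by
        nlinarith [abs_nonneg β, pow_nonneg (abs_nonneg a) 3, pow_nonneg (abs_nonneg b) 3]

/-- **Cubic bound for the force of the pinned chain, any real parameters**:
`|F_z(σ)| ≤ (|ω₂| + |lam| + 4 + 8|β|)(1 + |q_{z-1}|³ + |q_z|³ + |q_{z+1}|³)`. [folklore] -/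
theorem pinnedChain_abs_force_le (ω₂ lam β γ : ℝ) (σ : ChainConfig) (z : ℤ) :
    |(pinnedChain ω₂ lam β γ).force σ z| ≤
      (|ω₂| + |lam| + 4 + 8 * |β|) * (1 + (|(σ (z - 1)).1| ^ 3 + |(σ z).1| ^ 3 + |(σ (z + 1)).1| ^ 3)) := by
  rw [pinnedChain_force_eq]
  set a := (σ (z - 1)).1
  set b := (σ z).1
  set c := (σ (z + 1)).1
  have hb := abs_le_one_add_abs_pow_three b
  have hU : |-(ω₂ * b + lam * b ^ 3)| ≤ (|ω₂| + |lam|) * (1 + |b| ^ 3) := by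
    rw [abs_neg]
    calc |ω₂ * b + lam * b ^ 3| ≤ |ω₂| * |b| + |lam| * |b| ^ 3 := by
          refine (abs_add_le _ _).trans ?_; rw [abs_mul, abs_mul, abs_pow]
      _ ≤ |ω₂| * (1 + |b| ^ 3) + |lam| * (1 + |b| ^ 3) := by
          refine add_le_add (mul_le_mul_of_nonneg_left hb (abs_nonneg _)) (mul_le_mul_of_nonneg_left ?_ (abs_nonneg _))
          linarith [pow_nonneg (abs_nonneg b) 3]
      _ = (|ω₂| + |lam|) * (1 + |b| ^ 3) := by ring
  have h1 := abs_sub_add_mul_pow_le β c b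
  have h2 := abs_sub_add_mul_pow_le β b a
  have h3a := pow_nonneg (abs_nonneg a) 3
  have h3b := pow_nonneg (abs_nonneg b) 3
  have h3c := pow_nonneg (abs_nonneg c) 3
  calc _ ≤ |-(ω₂ * b + lam * b ^ 3) + (c - b + β * (c - b) ^ 3)| + |b - a + β * (b - a) ^ 3| := abs_sub _ _
    _ ≤ |-(ω₂ * b + lam * b ^ 3)| + |c - b + β * (c - b) ^ 3| + |b - a + β * (b - a) ^ 3| :=
        add_le_add (abs_add_le _ _) le_rfl
    _ ≤ (|ω₂| + |lam|) * (1 + |b| ^ 3) + (2 + 4 * |β|) * (1 + |c| ^ 3 + |b| ^ 3) +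
          (2 + 4 * |β|) * (1 + |b| ^ 3 + |a| ^ 3) := add_le_add (add_le_add hU h1) h2
    _ ≤ (|ω₂| + |lam| + 4 + 8 * |β|) * (1 + (|a| ^ 3 + |b| ^ 3 + |c| ^ 3)) := by
        nlinarith [abs_nonneg ω₂, abs_nonneg lam, abs_nonneg β, mul_nonneg (abs_nonneg β) h3a,
          mul_nonneg (abs_nonneg β) h3b, mul_nonneg (abs_nonneg β) h3c, mul_nonneg (abs_nonneg ω₂) h3a,
          mul_nonneg (abs_nonneg ω₂) h3c, mul_nonneg (abs_nonneg lam) h3a, mul_nonneg (abs_nonneg lam) h3c]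

/-! ### `𝒜(g ∘ box_R)` for `C¹` profiles: continuity, bound, convergence -/

/-- `boxRestrict R` is continuous. [folklore] -/
theorem continuous_boxRestrict (R : ℕ) : Continuous (boxRestrict R) :=
  continuous_pi fun _ => continuous_apply _

/-- **Continuity of `𝒜(g ∘ box_R)`** for the pinned chain and a `C¹` profile. [folklore] -/
theorem continuous_liouvilleZ_comp_boxRestrict (ω₂ lam β γ : ℝ) (R : ℕ) {g : (Fin (2 * R + 1) → ℝ × ℝ) → ℝ}
    (hg : ContDiff ℝ 1 g) : Continuous (liouvilleZ (pinnedChain ω₂ lam β γ) (g ∘ boxRestrict R)) := by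
  have heq : liouvilleZ (pinnedChain ω₂ lam β γ) (g ∘ boxRestrict R) = fun σ => ∑ i : Fin (2 * R + 1),
      ((σ ((i : ℤ) - R)).2 * fderiv ℝ g (boxRestrict R σ) (Pi.single i (1, 0)) +
        (pinnedChain ω₂ lam β γ).force σ ((i : ℤ) - R) * fderiv ℝ g (boxRestrict R σ) (Pi.single i (0, 1))) :=
    funext fun σ => liouvilleZ_comp_boxRestrict _ R σ ((hg.differentiable one_ne_zero) _)
  rw [heq]
  have hD : ∀ v : Fin (2 * R + 1) → ℝ × ℝ, Continuous fun σ : ChainConfig => fderiv ℝ g (boxRestrict R σ) v :=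
    fun v => ((hg.continuous_fderiv one_ne_zero).comp (continuous_boxRestrict R)).clm_apply continuous_const
  refine continuous_finsetSum _ fun i _ => ?_
  exact (((continuous_snd.comp (continuous_apply _)).mul (hD _))).add
    ((continuous_pinnedChain_force ω₂ lam β γ _).mul (hD _))

/-- `|𝒜(g ∘ box_R)(σ)| ≤ K ∑_i (|p_{i-R}| + |F_{i-R}(σ)|)` when `‖Dg‖ ≤ K` (any chain). [folklore] -/
theorem abs_liouvilleZ_comp_boxRestrict_le_sum (P : OscillatorChain) (R : ℕ) {g : (Fin (2 * R + 1) → ℝ × ℝ) → ℝ}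
    (hg : Differentiable ℝ g) {K : ℝ} (hK : ∀ y, ‖fderiv ℝ g y‖ ≤ K) (σ : ChainConfig) :
    |liouvilleZ P (g ∘ boxRestrict R) σ| ≤
      K * ∑ i : Fin (2 * R + 1), (|(σ ((i : ℤ) - R)).2| + |P.force σ ((i : ℤ) - R)|) := by
  have hK0 : 0 ≤ K := (norm_nonneg _).trans (hK (boxRestrict R σ))
  rw [liouvilleZ_comp_boxRestrict P R σ (hg _), Finset.mul_sum]
  refine (Finset.abs_sum_le_sum_abs _ _).trans (Finset.sum_le_sum fun i _ => ?_)
  have hDv : ∀ v : Fin (2 * R + 1) → ℝ × ℝ, ‖v‖ ≤ 1 → |fderiv ℝ g (boxRestrict R σ) v| ≤ K := by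
    intro v hv
    rw [← Real.norm_eq_abs]
    calc ‖fderiv ℝ g (boxRestrict R σ) v‖ ≤ ‖fderiv ℝ g (boxRestrict R σ)‖ * ‖v‖ := ContinuousLinearMap.le_opNorm _ _
      _ ≤ K * 1 := mul_le_mul (hK _) hv (norm_nonneg _) hK0
      _ = K := mul_one _
  have h1 : ‖(Pi.single i ((1 : ℝ), (0 : ℝ)) : Fin (2 * R + 1) → ℝ × ℝ)‖ ≤ 1 := by
    rw [Pi.norm_single]; simp [Prod.norm_def]
  have h2 : ‖(Pi.single i ((0 : ℝ), (1 : ℝ)) : Fin (2 * R + 1) → ℝ × ℝ)‖ ≤ 1 := by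
    rw [Pi.norm_single]; simp [Prod.norm_def]
  calc |(σ ((i : ℤ) - R)).2 * fderiv ℝ g (boxRestrict R σ) (Pi.single i (1, 0)) +
        P.force σ ((i : ℤ) - R) * fderiv ℝ g (boxRestrict R σ) (Pi.single i (0, 1))|
      ≤ |(σ ((i : ℤ) - R)).2| * |fderiv ℝ g (boxRestrict R σ) (Pi.single i (1, 0))| +
        |P.force σ ((i : ℤ) - R)| * |fderiv ℝ g (boxRestrict R σ) (Pi.single i (0, 1))| := by
          rw [← abs_mul, ← abs_mul]; exact abs_add_le _ _
    _ ≤ |(σ ((i : ℤ) - R)).2| * K + |P.force σ ((i : ℤ) - R)| * K :=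
          add_le_add (mul_le_mul_of_nonneg_left (hDv _ h1) (abs_nonneg _))
            (mul_le_mul_of_nonneg_left (hDv _ h2) (abs_nonneg _))
    _ = K * (|(σ ((i : ℤ) - R)).2| + |P.force σ ((i : ℤ) - R)|) := by ring

/-- **Moment bound for `𝒜(g ∘ box_R)` in site-weight form** (pinned chain, any real parameters): with
`C_F = |ω₂| + |lam| + 4 + 8|β|` and the box `s = {-R-1, …, R+1}`,
`|𝒜(g ∘ box_R)(σ)| ≤ K(2R+1)(1 + C_F) + K(2R+1)(1 + 3C_F) ∑_{z ∈ s} (|q_z|³ + |p_z|³)`. [folklore] -/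
theorem abs_liouvilleZ_comp_boxRestrict_le (ω₂ lam β γ : ℝ) (R : ℕ) {g : (Fin (2 * R + 1) → ℝ × ℝ) → ℝ}
    (hg : Differentiable ℝ g) {K : ℝ} (hK : ∀ y, ‖fderiv ℝ g y‖ ≤ K) (σ : ChainConfig) :
    |liouvilleZ (pinnedChain ω₂ lam β γ) (g ∘ boxRestrict R) σ| ≤
      K * (2 * R + 1) * (1 + (|ω₂| + |lam| + 4 + 8 * |β|)) +
        K * (2 * R + 1) * (1 + 3 * (|ω₂| + |lam| + 4 + 8 * |β|)) *
          ∑ z ∈ Finset.Icc (-(R : ℤ) - 1) (R + 1), (|(σ z).1| ^ 3 + |(σ z).2| ^ 3) := by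
  set P := pinnedChain ω₂ lam β γ with hP
  set C_F : ℝ := |ω₂| + |lam| + 4 + 8 * |β| with hCF
  set s : Finset ℤ := Finset.Icc (-(R : ℤ) - 1) (R + 1) with hs
  set W : ℝ := ∑ z ∈ s, (|(σ z).1| ^ 3 + |(σ z).2| ^ 3) with hW
  have hK0 : 0 ≤ K := (norm_nonneg _).trans (hK (boxRestrict R σ))
  have hCF0 : 0 ≤ C_F := by rw [hCF]; positivity
  have hWnn : ∀ z ∈ s, (0 : ℝ) ≤ |(σ z).1| ^ 3 + |(σ z).2| ^ 3 := fun z _ => by positivity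
  have hW0 : 0 ≤ W := Finset.sum_nonneg hWnn
  -- single-site bounds by the weight
  have hq3 : ∀ z ∈ s, |(σ z).1| ^ 3 ≤ W := fun z hz =>
    le_trans (le_add_of_nonneg_right (by positivity)) (Finset.single_le_sum hWnn hz)
  have hp3 : ∀ z ∈ s, |(σ z).2| ^ 3 ≤ W := fun z hz =>
    le_trans (le_add_of_nonneg_left (by positivity)) (Finset.single_le_sum hWnn hz)
  have hterm : ∀ i : Fin (2 * R + 1), |(σ ((i : ℤ) - R)).2| + |P.force σ ((i : ℤ) - R)| ≤
      (1 + C_F) + (1 + 3 * C_F) * W := by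
    intro i
    have hi := i.isLt
    set z : ℤ := (i : ℤ) - R with hz
    have hz0 : z ∈ s := by rw [hs, Finset.mem_Icc]; constructor <;> omega
    have hzm : z - 1 ∈ s := by rw [hs, Finset.mem_Icc]; constructor <;> omega
    have hzp : z + 1 ∈ s := by rw [hs, Finset.mem_Icc]; constructor <;> omega
    have hp : |(σ z).2| ≤ 1 + W := (abs_le_one_add_abs_pow_three _).trans (add_le_add le_rfl (hp3 z hz0))
    have hF := pinnedChain_abs_force_le ω₂ lam β γ σ z
    have hF' : |P.force σ z| ≤ C_F * (1 + 3 * W) := by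
      refine hF.trans (mul_le_mul_of_nonneg_left ?_ hCF0)
      linarith [hq3 _ hzm, hq3 _ hz0, hq3 _ hzp]
    nlinarith
  calc _ ≤ K * ∑ i : Fin (2 * R + 1), (|(σ ((i : ℤ) - R)).2| + |P.force σ ((i : ℤ) - R)|) :=
        abs_liouvilleZ_comp_boxRestrict_le_sum P R hg hK σ
    _ ≤ K * ∑ _i : Fin (2 * R + 1), ((1 + C_F) + (1 + 3 * C_F) * W) :=
        mul_le_mul_of_nonneg_left (Finset.sum_le_sum fun i _ => hterm i) hK0
    _ = K * (2 * R + 1) * (1 + C_F) + K * (2 * R + 1) * (1 + 3 * C_F) * W := by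
        rw [Finset.sum_const, Finset.card_univ, Fintype.card_fin, nsmul_eq_mul]; push_cast; ring

/-- **Pointwise convergence of `𝒜(g_j ∘ box_R)`** from pointwise convergence of the directional
derivatives of the profiles (any chain). [folklore] -/
theorem tendsto_liouvilleZ_comp_boxRestrict (P : OscillatorChain) (R : ℕ) {g : (Fin (2 * R + 1) → ℝ × ℝ) → ℝ}
    {gs : ℕ → (Fin (2 * R + 1) → ℝ × ℝ) → ℝ} (hg : Differentiable ℝ g) (hgs : ∀ j, Differentiable ℝ (gs j))
    (hD : ∀ y v, Tendsto (fun j => fderiv ℝ (gs j) y v) atTop (𝓝 (fderiv ℝ g y v))) (σ : ChainConfig) :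
    Tendsto (fun j => liouvilleZ P (gs j ∘ boxRestrict R) σ) atTop (𝓝 (liouvilleZ P (g ∘ boxRestrict R) σ)) := by
  have heq : ∀ j, liouvilleZ P (gs j ∘ boxRestrict R) σ = ∑ i : Fin (2 * R + 1),
      ((σ ((i : ℤ) - R)).2 * fderiv ℝ (gs j) (boxRestrict R σ) (Pi.single i (1, 0)) +
        P.force σ ((i : ℤ) - R) * fderiv ℝ (gs j) (boxRestrict R σ) (Pi.single i (0, 1))) :=
    fun j => liouvilleZ_comp_boxRestrict P R σ ((hgs j) _)
  simp only [heq]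
  rw [liouvilleZ_comp_boxRestrict P R σ (hg _)]
  refine tendsto_finsetSum _ fun i _ => ?_
  exact ((hD _ _).const_mul _).add ((hD _ _).const_mul _)

end Summit.AtomisticToContinuum.FouriersLaw.Theorems.WindowLimit

end
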